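import Literature.AlgebraicGeometry.Resolution.Blowups
import HarnessLib

/-!
# Dilatations (affine blowups, Néron blowups) of schemes: definition by the universal property

Topic: `Literature/AlgebraicGeometry/NeronModels`. Mayeux–Richarz–Romagny, *Néron blowups and
low-degree cohomological applications* (arXiv:2001.03597), §2: for closed subschemes `Z ⊆ D` of a
scheme `X` with `D` locally principal, with ideals `𝒥 = 𝓘_D ⊆ 𝓘 = 𝓘_Z`, the **dilatation**
(affine blowup, Néron blowup) **of `X` in `Z` along `D`** is the `X`-affine scheme
`Bl_Z^D X = Spec_X 𝒪_X[𝓘/𝒥]`, the spectrum of the affine blowup algebra (degree-`0` part of the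
Rees algebra `⨁ 𝓘ⁿ` localized at a local generator of `𝒥`; §2.1, Definition), equivalently the
open subscheme of the blowing up `Bl_Z X` complementary to `V₊(𝒥)` (§2.2, first Lemma). Over a
discrete valuation ring `R` with uniformizer `ϖ`, `D = X ⊗ k` the special fibre and `Z = Y` a
closed subscheme of `X ⊗ k`, this is the dilatation of `Y` in `X` of Bosch–Lütkebohmert–Raynaud,
*Néron Models*, §3.2 — the elementary step of Néron's smoothening process.

Exactly as the tree renders blowing ups (`Resolution.IsBlowup`, Görtz–Wedhorn Def. 13.90: the
universal property, not a construction), this file renders the dilatation by ITS universal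
property, MRR §2.3, Proposition: writing `Sch_X^{D-reg}` for the `X`-schemes `f : T → X` such
that `T ×_X D ⊆ T` is an effective Cartier divisor, "the affine blowup `Bl_Z^D X → X` represents
the contravariant functor `Sch_X^{D-reg} → Set` given by `(f : T → X) ↦ {∗}` if `f|_{T ×_X D}`
factors through `Z ⊆ X`; `∅`, else", and `Bl_Z^D X → X` is itself an object of `Sch_X^{D-reg}` on
which the structure map restricted to `Bl_Z^D X ×_X D` factors through `Z` (§2.2, second Lemma:
"`Bl_Z^D X ×_X Z = Bl_Z^D X ×_X D`, which is an effective Cartier divisor on `Bl_Z^D X`"); MRR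
note (§2.3, before the Proposition) that this functor "together with `id_{Bl_Z^D X}` determines
`Bl_Z^D X → X` uniquely up to unique isomorphism". In Mathlib's language (ideal sheaves
`X.IdealSheafData`, ordered as ideals, with `I.comap f` the ideal of the scheme-theoretic
preimage `T ×_X V(I)`):

* `IsDilatation π Z D` — `π : X' ⟶ X` **is a dilatation of `X` in (the closed subscheme of) `Z`
  along `D`**: (i) `D.comap π` is effective Cartier (`Resolution.IsEffectiveCartier`);
  (ii) `Z.comap π ≤ D.comap π`, i.e. `X' ×_X D ⊆ X' ×_X Z` as closed subschemes, i.e.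
  `π|_{X' ×_X D}` factors through `Z` (`comap_le_comap_iff_exists_fac` PROVES this reading);
  (iii) every `f : T ⟶ X` with (i) and (ii) factors uniquely through `π`.
  The inclusion `Z ⊆ D` of MRR (i.e. `D ≤ Z` as ideal sheaves) is not part of the predicate: by
  `isDilatation_sup_iff`, `IsDilatation π Z D ↔ IsDilatation π (Z ⊔ D) D` (dilatating in `Z` along
  `D` is dilatating in `Z ∩ D` along `D`), and the lemmas needing `Z ⊆ D` take `(hZD : D ≤ Z)`.

PROVED from the definition [folklore after MRR §2.2–2.5 unless cited]:

* the universal property as an API: `IsDilatation.hom_ext`, `lift`, `lift_comp`, `lift_unique`,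
  `eq_id_of_comp_eq`, `unique` (two dilatations are isomorphic over `X`), `comap_le_of_comp_eq`
  (the "`∅`, else" half of representability), `existsUnique_map` (functoriality, MRR §2.4, for
  `q : X₁ → X` with `D₁ = q⁻¹D` and `Z₁ ⊆ q⁻¹Z`);
* **exceptional divisor** (MRR §2.2 second Lemma, §2.6): `comap_eq` (`Z.comap π = D.comap π` when
  `D ≤ Z`) and `isEffectiveCartier_comap_centre` (`X' ×_X Z` is an effective Cartier divisor);
* `IsDilatation.id`, `isIso` (if `D` is already an effective Cartier divisor of `X` containing
  `Z`-as-ideal, the identity is the dilatation: MRR §2.3 with `T = X`), `restrict` (Zariski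
  localisation on `X`, the "claim is Zariski local on `X`" steps of MRR §2.2–2.5),
  `isIso_morphismRestrict` / `isIso_compl` (**`π` is an isomorphism over `X ∖ D`**; affine-locally
  MRR §2.1 "`B[I/b][b⁻¹] = B[b⁻¹]`");
* `isDilatation_self_iff` — `Bl_D^D X = Bl_D X`: dilatating in `D` along `D` is blowing up `D`
  (`Resolution.IsBlowup`); `IsDilatation.toBlowup` / `toBlowup_comp` / `toBlowup_unique` — the
  canonical `X`-morphism `Bl_Z^D X → Bl_Z X` of MRR §2.2, first Lemma (that it is an open
  immersion onto the complement of `V₊(𝒥)` is NOT proved here);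
* **base change** (MRR §2.5, Lemma, as printed: "If `Bl_Z^D X ×_X X' → X'` is an object of
  `Sch_{X'}^{D'-reg}`, then `Bl_{Z'}^{D'} X' → Bl_Z^D X ×_X X'` is an isomorphism"):
  `IsDilatation.of_isPullback` — for a cartesian square over `ι : S ⟶ X`, if the base change
  `X' ×_X S → S` pulls `D` back to an effective Cartier divisor then it is the dilatation of `S`
  in `ι⁻¹Z` along `ι⁻¹D`; `IsDilatation.pullback_snd` for the chosen fibre product. The flat case
  (MRR §2.5, Corollary) is in `DilatationFlat.lean`.

Existence — MRR's construction — is proved in the affine, principal case in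
`DilatationAffine.lean` (`Spec A[I/b] → Spec A` is a dilatation of `Spec A` in `V(I)` along
`V(b)`, MRR §2.3 proof), on the tree's affine blowup algebra `Resolution.blowupAlgebra I b ⊆ A[1/b]`
(= `Dilatations.dilatation ϖ I` for `b` the image of a uniformizer); the global object (relative
`Spec`, or the open of `Bl_Z X`) is not constructed in this file.

## References

* A. Mayeux, T. Richarz, M. Romagny, *Néron blowups and low-degree cohomological applications*,
  arXiv:2001.03597 (2020), §2.1 (Definition), §2.2 (Lemmas: open in `Bl_Z X`; exceptional
  divisor), §2.3 (Proposition: universal property), §2.5 (Lemma: base change).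
  [MayeuxRicharzRomagny2020]
* S. Bosch, W. Lütkebohmert, M. Raynaud, *Néron Models*, Springer 1990, §3.2, Prop. 3.2/1.
  [BLRNeronModels1990] (Not held; numbers only.)
* U. Görtz, T. Wedhorn, *Algebraic Geometry I*, 2nd ed. (2020), Def. 13.90 (blow-ups by the
  universal property; the model for `IsBlowup` and for this file). [GortzWedhorn2020]

## Design notes

* A `Prop`-valued structure on a morphism and two ideal sheaves, quantifying over test schemes in
  the universe of `X` (as `IsBlowup` does); no Noetherian or finiteness hypothesis.
* MRR's "`f|_{T ×_X D}` factors through `Z`" is recorded as the inequality of ideal sheaves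
  `Z.comap f ≤ D.comap f` (Mathlib's Galois connection `le_map_iff_comap_le`); the equivalence with
  the existence of a factorisation `T ×_X D → Z` over `X` is `comap_le_comap_iff_exists_fac`.
-/

noncomputable section

open CategoryTheory CategoryTheory.Limits AlgebraicGeometry TopologicalSpace
open Literature.AlgebraicGeometry.Resolution

namespace Literature.AlgebraicGeometry.NeronModels

universe u

/-! ## "`f` restricted to `T ×_X D` factors through `Z`" as an inequality of ideal sheaves -/

section Factors

variable {T X : Scheme.{u}} (f : T ⟶ X) (Z D : X.IdealSheafData)

/-- For `f : T ⟶ X` and closed subschemes `Z = V(𝓘_Z)`, `D = V(𝓘_D)` of `X`: the inverse image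
ideal sheaves satisfy `𝓘_Z 𝒪_T ⊆ 𝓘_D 𝒪_T` (i.e. `T ×_X D ⊆ T ×_X Z` as closed subschemes of `T`)
iff the restriction of `f` to `T ×_X D` factors through `Z ↪ X` — MRR's formulation of the
condition in the universal property of dilatations. [cite: MayeuxRicharzRomagny2020, §2.3 (Proposition)] -/
theorem comap_le_comap_iff_exists_fac :
    Z.comap f ≤ D.comap f ↔
      ∃ h : (D.comap f).subscheme ⟶ Z.subscheme,
        h ≫ Z.subschemeι = (D.comap f).subschemeι ≫ f := by
  constructor
  · intro hle
    have H : Z ≤ (D.comap f).map f := Scheme.IdealSheafData.le_map_iff_comap_le.mpr hle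
    exact ⟨Scheme.IdealSheafData.subschemeMap _ _ f H,
      Scheme.IdealSheafData.subschemeMap_subschemeι _ _ f H⟩
  · rintro ⟨h, hh⟩
    rw [← Scheme.IdealSheafData.le_map_iff_comap_le, Scheme.IdealSheafData.map, ← hh]
    calc Z = Z.subschemeι.ker := Z.ker_subschemeι.symm
      _ ≤ (h ≫ Z.subschemeι).ker := Scheme.Hom.le_ker_comp _ _

/-- The condition is insensitive to replacing `Z` by `Z ∩ D` (ideal sheaf `Z ⊔ D`). [folklore] -/
theorem sup_comap_le_comap_iff : (Z ⊔ D).comap f ≤ D.comap f ↔ Z.comap f ≤ D.comap f := by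
  rw [Scheme.IdealSheafData.comap_sup, sup_le_iff, and_iff_left le_rfl]

end Factors

/-! ## Dilatations -/

/-- `π : X' ⟶ X` **is a dilatation (affine blowup, Néron blowup) of `X` in `Z` along `D`**, for
ideal sheaves `Z` (the centre) and `D` (in MRR: `V(Z) ⊆ V(D)`, `D` locally principal), in the sense
of the universal property of Mayeux–Richarz–Romagny §2.3, Proposition, with §2.2, second Lemma:
(i) `X' ×_X D ⊆ X'` is an effective Cartier divisor; (ii) `X' ×_X D ⊆ X' ×_X Z`, i.e. `π`
restricted to `X' ×_X D` factors through `Z`; (iii) `π` is terminal among the `f : T ⟶ X` with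
(i) and (ii): each such `f` factors uniquely through `π`. Unique up to unique isomorphism; it is
`Spec_X 𝒪_X[𝓘_Z/𝓘_D]` when `D` is locally principal (MRR §2.1; affine case in
`DilatationAffine.lean`). [cite: MayeuxRicharzRomagny2020, §2.3 (Proposition) and §2.2 (Lemma)] -/
structure IsDilatation {X' X : Scheme.{u}} (π : X' ⟶ X) (Z D : X.IdealSheafData) : Prop where
  /-- `X' ×_X D ⊆ X'` is an effective Cartier divisor (`X' ∈ Sch_X^{D-reg}`) -/
  isEffectiveCartier : IsEffectiveCartier (D.comap π)
  /-- `X' ×_X D ⊆ X' ×_X Z`: the structure map restricted to `X' ×_X D` factors through `Z` -/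
  comap_le : Z.comap π ≤ D.comap π
  /-- universality: every `f : T ⟶ X` in `Sch_X^{D-reg}` whose restriction to `T ×_X D` factors
  through `Z` factors uniquely through `π` -/
  universal : ∀ ⦃T : Scheme.{u}⦄ (f : T ⟶ X), IsEffectiveCartier (D.comap f) →
    Z.comap f ≤ D.comap f → ∃! g : T ⟶ X', g ≫ π = f

namespace IsDilatation

variable {X' X : Scheme.{u}} {π : X' ⟶ X} {Z D : X.IdealSheafData}

/-! ### The exceptional divisor (MRR §2.2, second Lemma; §2.6) -/

/-- **`X' ×_X Z = X' ×_X D`** as closed subschemes of the dilatation, when `Z ⊆ D`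
(MRR §2.2, second Lemma). [cite: MayeuxRicharzRomagny2020, §2.2 (Lemma)] -/
theorem comap_eq (h : IsDilatation π Z D) (hZD : D ≤ Z) : Z.comap π = D.comap π :=
  le_antisymm h.comap_le (Scheme.IdealSheafData.comap_mono π hZD)

/-- **The exceptional divisor `X' ×_X Z` of a dilatation is an effective Cartier divisor**, when
`Z ⊆ D` (MRR §2.2, second Lemma; §2.6 "It is called the exceptional divisor of the affine
blowup"). [cite: MayeuxRicharzRomagny2020, §2.2 (Lemma)] -/
theorem isEffectiveCartier_comap_centre (h : IsDilatation π Z D) (hZD : D ≤ Z) :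
    IsEffectiveCartier (Z.comap π) :=
  h.comap_eq hZD ▸ h.isEffectiveCartier

/-! ### The universal property as an API -/

/-- For a morphism `g : T ⟶ X'` INTO a dilatation, condition (ii) for `g ≫ π` is automatic.
[folklore] -/
theorem comap_comp_le (h : IsDilatation π Z D) {T : Scheme.{u}} (g : T ⟶ X') :
    Z.comap (g ≫ π) ≤ D.comap (g ≫ π) := by
  rw [Scheme.IdealSheafData.comap_comp, Scheme.IdealSheafData.comap_comp]
  exact Scheme.IdealSheafData.comap_mono g h.comap_le

/-- Two morphisms into a dilatation that agree after composing with `π` are equal, as soon as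
the (common) composite pulls `D` back to an effective Cartier divisor (MRR §2.3, injectivity).
[cite: MayeuxRicharzRomagny2020, §2.3 (Proposition)] -/
theorem hom_ext (h : IsDilatation π Z D) {T : Scheme.{u}} {g₁ g₂ : T ⟶ X'}
    (hT : IsEffectiveCartier (D.comap (g₁ ≫ π))) (e : g₁ ≫ π = g₂ ≫ π) : g₁ = g₂ :=
  (h.universal (g₁ ≫ π) hT (h.comap_comp_le g₁)).unique rfl e.symm

/-- The morphism to the dilatation provided by the universal property, for `f : T ⟶ X` pulling
`D` back to an effective Cartier divisor contained (as a subscheme) in the preimage of `Z`.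
[cite: MayeuxRicharzRomagny2020, §2.3 (Proposition)] -/
def lift (h : IsDilatation π Z D) {T : Scheme.{u}} (f : T ⟶ X)
    (hf : IsEffectiveCartier (D.comap f)) (hZ : Z.comap f ≤ D.comap f) : T ⟶ X' :=
  (h.universal f hf hZ).exists.choose

/-- The lift composes with `π` to the given morphism. [folklore] -/
@[reassoc (attr := simp)]
theorem lift_comp (h : IsDilatation π Z D) {T : Scheme.{u}} (f : T ⟶ X)
    (hf : IsEffectiveCartier (D.comap f)) (hZ : Z.comap f ≤ D.comap f) :
    h.lift f hf hZ ≫ π = f :=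
  (h.universal f hf hZ).exists.choose_spec

/-- Uniqueness of the lift. [folklore] -/
theorem lift_unique (h : IsDilatation π Z D) {T : Scheme.{u}} (f : T ⟶ X)
    (hf : IsEffectiveCartier (D.comap f)) (hZ : Z.comap f ≤ D.comap f) {g : T ⟶ X'}
    (hg : g ≫ π = f) : g = h.lift f hf hZ :=
  (h.universal f hf hZ).unique hg (h.lift_comp f hf hZ)

/-- An endomorphism of a dilatation over `X` is the identity. [folklore] -/
theorem eq_id_of_comp_eq (h : IsDilatation π Z D) {g : X' ⟶ X'} (hg : g ≫ π = π) : g = 𝟙 X' :=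
  h.hom_ext (by simpa [hg] using h.isEffectiveCartier) (by simp [hg])

/-- **Uniqueness up to isomorphism** (MRR §2.3: the functor "determines `Bl_Z^D X → X` uniquely
up to unique isomorphism"): two dilatations of `X` in `Z` along `D` are isomorphic over `X`.
[cite: MayeuxRicharzRomagny2020, §2.3] -/
theorem unique {X'' : Scheme.{u}} {π' : X'' ⟶ X} (h : IsDilatation π Z D)
    (h' : IsDilatation π' Z D) : ∃ e : X' ≅ X'', e.hom ≫ π' = π ∧ e.inv ≫ π = π' := by
  obtain ⟨a, ha, -⟩ := h'.universal π h.isEffectiveCartier h.comap_le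
  obtain ⟨b, hb, -⟩ := h.universal π' h'.isEffectiveCartier h'.comap_le
  refine ⟨⟨a, b, ?_, ?_⟩, ha, hb⟩
  · apply h.hom_ext
    · simpa [ha, hb] using h.isEffectiveCartier
    · simp [ha, hb]
  · apply h'.hom_ext
    · simpa [ha, hb] using h'.isEffectiveCartier
    · simp [ha, hb]

/-- The "`∅`, else" half of representability (MRR §2.3, Proposition): if `f : T ⟶ X` factors
through the dilatation at all, then `f` restricted to `T ×_X D` factors through `Z`.
[cite: MayeuxRicharzRomagny2020, §2.3 (Proposition)] -/
theorem comap_le_of_comp_eq (h : IsDilatation π Z D) {T : Scheme.{u}} {f : T ⟶ X} {g : T ⟶ X'}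
    (hg : g ≫ π = f) : Z.comap f ≤ D.comap f :=
  hg ▸ h.comap_comp_le g

/-! ### Functoriality (MRR §2.4), for `D₁ = q⁻¹D` -/

/-- **Functoriality of dilatations** (MRR §2.4, in the case where the divisor upstairs is the
full preimage): for `q : X₁ ⟶ X`, a dilatation `π₁` of `X₁` in `Z₁` along `q⁻¹D` with
`Z₁ ⊆ q⁻¹Z` (as subschemes: `Z.comap q ≤ Z₁`) maps uniquely to a dilatation `π` of `X` in `Z`
along `D`, over `q` — because `π₁ ≫ q` pulls `D` back to the effective Cartier divisor
`π₁⁻¹(q⁻¹D) ⊆ π₁⁻¹ Z₁ ⊆ (π₁ ≫ q)⁻¹ Z`. [cite: MayeuxRicharzRomagny2020, §2.4] -/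
theorem existsUnique_map (h : IsDilatation π Z D) {X₁' X₁ : Scheme.{u}} {π₁ : X₁' ⟶ X₁}
    {Z₁ : X₁.IdealSheafData} (q : X₁ ⟶ X) (h₁ : IsDilatation π₁ Z₁ (D.comap q))
    (hZ : Z.comap q ≤ Z₁) : ∃! g : X₁' ⟶ X', g ≫ π = π₁ ≫ q := by
  refine h.universal (π₁ ≫ q) ?_ ?_
  · rw [Scheme.IdealSheafData.comap_comp]
    exact h₁.isEffectiveCartier
  · rw [Scheme.IdealSheafData.comap_comp, Scheme.IdealSheafData.comap_comp]
    exact (Scheme.IdealSheafData.comap_mono π₁ hZ).trans h₁.comap_le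

/-! ### Degenerate cases -/

/-- If `D` is already an effective Cartier divisor of `X` and `𝓘_Z ⊆ 𝓘_D` (so `Z ∩ D = D`), the
identity of `X` is a dilatation of `X` in `Z` along `D` (MRR §2.3 with `T = X`). [folklore] -/
protected theorem id (hD : IsEffectiveCartier D) (hZ : Z ≤ D) : IsDilatation (𝟙 X) Z D := by
  refine ⟨by simpa using hD, by simpa using hZ, fun T f _ _ => ⟨f, Category.comp_id f, ?_⟩⟩
  intro g hg
  simpa using hg

/-- In the situation of `IsDilatation.id`, every dilatation is an isomorphism. [folklore] -/
theorem isIso (h : IsDilatation π Z D) (hD : IsEffectiveCartier D) (hZ : Z ≤ D) : IsIso π := by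
  obtain ⟨s, hs, -⟩ := h.universal (𝟙 X) (by simpa using hD) (by simpa using hZ)
  refine ⟨s, ?_, hs⟩
  apply h.hom_ext
  · simpa [hs] using h.isEffectiveCartier
  · simp [hs]

/-! ### Zariski localisation on `X` -/

/-- **Dilatations restrict over opens of `X`**: over `U ⊆ X`, a dilatation of `X` in `Z` along
`D` restricts to a dilatation of `U` in `Z|_U` along `D|_U` (the "Zariski local on `X`"
reductions of MRR §2.2–2.5; proved from the universal property). [folklore] -/
theorem restrict (h : IsDilatation π Z D) (U : X.Opens) :
    IsDilatation (π ∣_ U) (Z.comap U.ι) (D.comap U.ι) := by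
  refine ⟨?_, ?_, ?_⟩
  · rw [← Scheme.IdealSheafData.comap_comp, morphismRestrict_ι,
      Scheme.IdealSheafData.comap_comp]
    exact h.isEffectiveCartier.comap_ι _
  · rw [← Scheme.IdealSheafData.comap_comp, ← Scheme.IdealSheafData.comap_comp,
      morphismRestrict_ι, Scheme.IdealSheafData.comap_comp, Scheme.IdealSheafData.comap_comp]
    exact Scheme.IdealSheafData.comap_mono _ h.comap_le
  · intro W f hf hZ
    have hf' : IsEffectiveCartier (D.comap (f ≫ U.ι)) := by
      rwa [Scheme.IdealSheafData.comap_comp]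
    have hZ' : Z.comap (f ≫ U.ι) ≤ D.comap (f ≫ U.ι) := by
      rwa [Scheme.IdealSheafData.comap_comp, Scheme.IdealSheafData.comap_comp]
    obtain ⟨g, hg, huniq⟩ := h.universal (f ≫ U.ι) hf' hZ'
    have hrange : Set.range g ⊆ Set.range (π ⁻¹ᵁ U).ι := by
      rintro _ ⟨w, rfl⟩
      rw [Scheme.Opens.range_ι]
      change π (g w) ∈ U
      rw [← Scheme.Hom.comp_apply, hg, Scheme.Hom.comp_apply]
      exact (f w).2
    refine ⟨IsOpenImmersion.lift (π ⁻¹ᵁ U).ι g hrange, ?_, ?_⟩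
    · change IsOpenImmersion.lift (π ⁻¹ᵁ U).ι g hrange ≫ π ∣_ U = f
      rw [← cancel_mono U.ι, Category.assoc, morphismRestrict_ι,
        IsOpenImmersion.lift_fac_assoc, hg]
    · intro g' (hg' : g' ≫ π ∣_ U = f)
      rw [← cancel_mono (π ⁻¹ᵁ U).ι, IsOpenImmersion.lift_fac]
      apply huniq
      rw [Category.assoc, ← morphismRestrict_ι, reassoc_of% hg']

/-- **A dilatation is an isomorphism away from `D`**: if the open `U ⊆ X` does not meet `V(D)`,
then `π` restricts to an isomorphism `π⁻¹(U) ≅ U` (affine-locally MRR §2.1,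
"`B[I/b][b⁻¹] = B[b⁻¹]`"). [cite: MayeuxRicharzRomagny2020, §2.1] -/
theorem isIso_morphismRestrict (h : IsDilatation π Z D) {U : X.Opens}
    (hU : Disjoint (U : Set X) D.support) : IsIso (π ∣_ U) := by
  have hD : D.comap U.ι = ⊤ := by
    rw [← Scheme.IdealSheafData.support_eq_bot_iff, Scheme.IdealSheafData.support_comap]
    ext x
    simp only [Closeds.coe_preimage, Set.mem_preimage, Closeds.coe_bot, Set.mem_empty_iff_false,
      iff_false]
    intro hx
    exact Set.disjoint_left.mp hU x.2 hx
  have h' := h.restrict U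
  rw [hD] at h'
  exact h'.isIso isEffectiveCartier_top le_top

/-- A dilatation restricts to an isomorphism over the open complement `X ∖ V(D)`.
[cite: MayeuxRicharzRomagny2020, §2.1] -/
theorem isIso_compl (h : IsDilatation π Z D) :
    IsIso (π ∣_ ⟨(D.support : Set X)ᶜ, D.support.isClosed.isOpen_compl⟩) :=
  h.isIso_morphismRestrict disjoint_compl_left

/-! ### Base change (MRR §2.5, Lemma) -/

/-- **Base change of dilatations** (MRR §2.5, Lemma: "If `Bl_Z^D X ×_X X' → X'` is an object of
`Sch_{X'}^{D'-reg}`, then `Bl_{Z'}^{D'} X' → Bl_Z^D X ×_X X'` is an isomorphism", `Z'`, `D'` the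
preimages), for an arbitrary cartesian square `fst ≫ π = snd ≫ ι`: if `π` is a dilatation of `X`
in `Z` along `D` and `snd : P ⟶ S` pulls `ι⁻¹D` back to an effective Cartier divisor, then `snd`
is a dilatation of `S` in `ι⁻¹Z` along `ι⁻¹D`. The universal property of `snd` is that of `π`
composed with that of the fibre product. [cite: MayeuxRicharzRomagny2020, §2.5 (Lemma)] -/
theorem of_isPullback {P S : Scheme.{u}} {fst : P ⟶ X'} {snd : P ⟶ S} {ι : S ⟶ X}
    (H : IsPullback fst snd π ι) (h : IsDilatation π Z D)
    (hP : IsEffectiveCartier ((D.comap ι).comap snd)) :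
    IsDilatation snd (Z.comap ι) (D.comap ι) := by
  refine ⟨hP, ?_, ?_⟩
  · rw [← Scheme.IdealSheafData.comap_comp, ← Scheme.IdealSheafData.comap_comp, ← H.w]
    exact h.comap_comp_le fst
  · intro W a ha hZa
    rw [← Scheme.IdealSheafData.comap_comp] at ha
    rw [← Scheme.IdealSheafData.comap_comp, ← Scheme.IdealSheafData.comap_comp] at hZa
    obtain ⟨b, hb, hbu⟩ := h.universal (a ≫ ι) ha hZa
    refine ⟨H.lift b a hb, H.lift_snd b a hb, fun c hc => ?_⟩
    have hc : c ≫ snd = a := hc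
    apply H.hom_ext
    · rw [H.lift_fst]
      exact hbu _ (show (c ≫ fst) ≫ π = a ≫ ι by rw [Category.assoc, H.w, reassoc_of% hc])
    · rw [H.lift_snd, hc]

/-- **Base change of dilatations**, for the chosen fibre product: if `π` is a dilatation of `X`
in `Z` along `D`, `ι : S ⟶ X`, and `X' ×_X S → S` pulls `ι⁻¹D` back to an effective Cartier
divisor, then `pullback.snd π ι` is a dilatation of `S` in `ι⁻¹Z` along `ι⁻¹D`.
[cite: MayeuxRicharzRomagny2020, §2.5 (Lemma)] -/
theorem pullback_snd {S : Scheme.{u}} (h : IsDilatation π Z D) (ι : S ⟶ X)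
    (hP : IsEffectiveCartier ((D.comap ι).comap (pullback.snd π ι))) :
    IsDilatation (pullback.snd π ι) (Z.comap ι) (D.comap ι) :=
  h.of_isPullback (IsPullback.of_hasPullback π ι) hP

end IsDilatation

/-! ## Dilatations and blowing ups -/

section Blowup

variable {X' X : Scheme.{u}} {π : X' ⟶ X} {Z D : X.IdealSheafData}

/-- Dilatating in `Z` along `D` is dilatating in `Z ∩ D` (ideal sheaf `Z ⊔ D`) along `D`: the
predicate does not see the difference, so MRR's standing assumption `Z ⊆ D` costs nothing.
[folklore] -/
theorem isDilatation_sup_iff : IsDilatation π (Z ⊔ D) D ↔ IsDilatation π Z D := by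
  constructor
  · intro h
    exact ⟨h.isEffectiveCartier, (sup_comap_le_comap_iff π Z D).mp h.comap_le,
      fun T f hf hZ => h.universal f hf ((sup_comap_le_comap_iff f Z D).mpr hZ)⟩
  · intro h
    exact ⟨h.isEffectiveCartier, (sup_comap_le_comap_iff π Z D).mpr h.comap_le,
      fun T f hf hZ => h.universal f hf ((sup_comap_le_comap_iff f Z D).mp hZ)⟩

/-- **`Bl_D^D X = Bl_D X`**: a dilatation of `X` in `D` along `D` is the same as a blowing up of
`X` along `D` (`Resolution.IsBlowup`, GW Def. 13.90) — condition (ii) is vacuous for `Z = D`.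
[folklore] -/
theorem isDilatation_self_iff : IsDilatation π D D ↔ IsBlowup π D :=
  ⟨fun h => ⟨h.isEffectiveCartier, fun _ f hf => h.universal f hf le_rfl⟩,
    fun h => ⟨h.isEffectiveCartier, le_rfl, fun _ f hf _ => h.universal f hf⟩⟩

variable {B : Scheme.{u}} {p : B ⟶ X}

/-- **The canonical `X`-morphism from the dilatation to the blowing up `Bl_Z X`** (MRR §2.2, first
Lemma: `Bl_Z^D X` is an open subscheme of `Bl_Z X`; here only the morphism, from the universal
property of the blowing up applied to the effective Cartier divisor `X' ×_X Z = X' ×_X D`).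
[cite: MayeuxRicharzRomagny2020, §2.2 (Lemma)] -/
def IsDilatation.toBlowup (h : IsDilatation π Z D) (hB : IsBlowup p Z) (hZD : D ≤ Z) : X' ⟶ B :=
  hB.lift π (h.isEffectiveCartier_comap_centre hZD)

/-- The canonical morphism to the blowing up is a morphism over `X`. [cite: MayeuxRicharzRomagny2020, §2.2 (Lemma)] -/
@[reassoc (attr := simp)]
theorem IsDilatation.toBlowup_comp (h : IsDilatation π Z D) (hB : IsBlowup p Z) (hZD : D ≤ Z) :
    h.toBlowup hB hZD ≫ p = π :=
  hB.lift_comp π _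

/-- The canonical morphism to the blowing up is the only `X`-morphism `X' → Bl_Z X`. [folklore] -/
theorem IsDilatation.toBlowup_unique (h : IsDilatation π Z D) (hB : IsBlowup p Z) (hZD : D ≤ Z)
    {g : X' ⟶ B} (hg : g ≫ p = π) : g = h.toBlowup hB hZD :=
  hB.lift_unique π _ hg

end Blowup

end Literature.AlgebraicGeometry.NeronModels

end
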